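import Literature.Topology.FourManifolds.RoundSolidTorusMeridianKernel
import Literature.Topology.FourManifolds.HandlebodyMirrorSymmetry
import HarnessLib

/-!
# Extendable diffeomorphisms of the round solid torus: meridional twists and the mirror

Topic `Literature/Topology/FourManifolds`; written for the fact debt
`Literature.Topology.FourManifolds.GriffithsExtension` (`HandlebodyKernelExtension.lean`;
H. B. Griffiths, *Automorphisms of a 3-dimensional handlebody*, Abh. Math. Sem. Univ. Hamburg 26
(1964): a kernel-preserving self-diffeomorphism of the boundary of a handlebody extends), genus-`1`
model `V = RoundSolidTorus = {(x² + y² − 4)² + 16 z² ≤ 1} ⊂ ℝ³` (`RoundSolidTorus.lean`).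
`DehnNielsenBaerTorus.lean` realises every integer matrix `(a b; c d) ∈ GL(2, ℤ)` as a
diffeomorphism `boundaryMatrixDiffeo` of the boundary torus `∂V` (longitude `θ ↦ aθ + bφ`,
meridian angle `φ ↦ cθ + dφ`).  Here we prove that **the lower-triangular ones, `b = 0`
(`a, d = ±1`), extend to diffeomorphisms of the solid torus `V`** — these are exactly the matrices
preserving the meridian subgroup `⟨g₂⟩ = ker (π₁ ∂V → π₁ V)`
(`RoundSolidTorusMeridianKernel.lean`, `ker_map_incl_eq_zpowers_meridianClass`),
and their extendability is the constructive half of Griffiths' theorem in genus `1` (the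
handlebody group of the solid torus surjects onto the stabiliser of the meridian; e.g.
Farb–Margalit, *A primer on mapping class groups* (2012), §2.2.4 and Thm. 2.5, for the torus, and
the classical description of `Mod(S¹ × D²)`).  Everything is **proved**; the new definitions are
concrete maps with bodies; no named fact is introduced.

* §1 Coordinates: off the `z`-axis a point of `ℝ³` is determined by its longitude unit complex
  number `longC = (x + iy)/|x + iy|` and its meridian number `merC = (x² + y² − 4) + 4iz`
  (`ptOf_longC_merC`), and `ambientMatrixMap a b c d q = ptOf (longC^a merC^b) (longC^c merC^d)`.
* §2 **The meridional twists** `E_{a,c} = ambientMatrixMap a 0 c 1`: `longC ↦ longC^a`,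
  `merC ↦ longC^c · merC` (`a = ±1`, `c ∈ ℤ`) — the rotation of each meridian disc
  `{θ = const}` through the angle `cθ` (`c` Dehn twists along the meridian disc), composed with
  the reflection `θ ↦ −θ` when `a = −1`.  They preserve `G = |merC|² − 1`, hence `V` and `∂V`,
  are smooth near `V`, and `E_{a,−ac} ∘ E_{a,c} = id`; as self-diffeomorphisms of the manifold
  with boundary `V`: `solidTwistDiffeo a c` (smooth into the regular domain by Lee (2013),
  Cor. 5.30, `HalfSliceAtlas.contMDiffAt_codRestrict`).
* §3 **The mirror** `(x, y, z) ↦ (x, y, −z)` of `V` (`mirrorDiffeo`, the tree's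
  `RegularSublevel.mirror`: the Morse function `f` of `V` is even in `z`), restricting to
  `(θ, φ) ↦ (θ, −φ)` on `∂V`.
* §4 **Extendability**: every self-diffeomorphism of `∂V` whose underlying map is
  `boundaryMatrixFun a 0 c d` with `a, d ∈ {1, −1}` extends over `V`
  (`diffeoExtends_of_coe_eq_boundaryMatrixFun`; witness `E_{a,c}` for `d = 1` and
  `mirror ∘ E_{a,−c}` for `d = −1`), in particular `boundaryMatrixDiffeo a 0 c d …`
  (`diffeoExtends_boundaryMatrixDiffeo`), in the sense `BoundaryData.DiffeoExtends` of the
  boundary datum `BoundaryManifold.boundaryData 2 V`.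

## References

* H. B. Griffiths, *Automorphisms of a 3-dimensional handlebody*, Abh. Math. Sem. Univ. Hamburg
  26 (1964) 191–210. [GriffithsHB1964Handlebody]
* B. Farb, D. Margalit, *A primer on mapping class groups*, PMS 49 (2012), §2.2.4, Thm. 2.5.
  [FarbMargalit2012]
* J. M. Lee, *Introduction to Smooth Manifolds*, 2nd ed. (2013), Cor. 5.30. [LeeSmoothManifolds2013]
-/

open scoped Manifold ContDiff Topology Real
open Set Function

noncomputable section

namespace Literature.Topology.FourManifolds

open Literature.Topology.Euclidean

namespace RoundSolidTorusModel

/-! ### §1 Longitude and meridian coordinates -/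

/-- Points of `V` satisfy `G ≤ 0`. [folklore] -/
theorem G_incl_nonpos (p : RoundSolidTorus) : G (RegularSublevel.incl isRegularLevel_fn p) ≤ 0 :=
  (fn_nonpos_iff _).1 (RegularSublevel.apply_incl_le isRegularLevel_fn p)

/-- The real part of the meridian number: `x² + y² − 4`. [folklore] -/
theorem merC_re (q : EuclideanSpace ℝ (Fin 3)) : (merC q).re = q 0 ^ 2 + q 1 ^ 2 - 4 := by
  simp [merC]

/-- The imaginary part of the meridian number: `4z`. [folklore] -/
theorem merC_im (q : EuclideanSpace ℝ (Fin 3)) : (merC q).im = 4 * q 2 := by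
  simp [merC]

/-- The longitude unit number, with a real scalar: `(x + iy) · (1/√(x² + y²))`. [folklore] -/
theorem longC_eq (q : EuclideanSpace ℝ (Fin 3)) :
    longC q = ((q 0 : ℂ) + (q 1 : ℂ) * Complex.I) * (((√(q 0 ^ 2 + q 1 ^ 2))⁻¹ : ℝ) : ℂ) := by
  rw [longC, Complex.ofReal_inv]

/-- The real part of the longitude number: `x/√(x² + y²)`. [folklore] -/
theorem longC_re (q : EuclideanSpace ℝ (Fin 3)) : (longC q).re = q 0 * (√(q 0 ^ 2 + q 1 ^ 2))⁻¹ := by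
  rw [longC_eq, Complex.re_mul_ofReal]
  simp

/-- The imaginary part of the longitude number: `y/√(x² + y²)`. [folklore] -/
theorem longC_im (q : EuclideanSpace ℝ (Fin 3)) : (longC q).im = q 1 * (√(q 0 ^ 2 + q 1 ^ 2))⁻¹ := by
  rw [longC_eq, Complex.im_mul_ofReal]
  simp

/-- Off the `z`-axis the longitude number is a unit: `|longC|² = 1`. [folklore] -/
theorem normSq_longC {q : EuclideanSpace ℝ (Fin 3)} (hq : 0 < q 0 ^ 2 + q 1 ^ 2) :
    Complex.normSq (longC q) = 1 := by
  have hs : 0 < √(q 0 ^ 2 + q 1 ^ 2) := Real.sqrt_pos.2 hq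
  have hss : √(q 0 ^ 2 + q 1 ^ 2) ^ 2 = q 0 ^ 2 + q 1 ^ 2 := Real.sq_sqrt hq.le
  rw [Complex.normSq_apply, longC_re, longC_im]
  field_simp
  rw [hss]

/-- Off the `z`-axis the longitude number is nonzero. [folklore] -/
theorem longC_ne_zero {q : EuclideanSpace ℝ (Fin 3)} (hq : 0 < q 0 ^ 2 + q 1 ^ 2) : longC q ≠ 0 := by
  intro h
  have h1 := normSq_longC hq
  rw [h, map_zero] at h1
  exact zero_ne_one h1

/-- **The point of `ℝ³` with longitude unit `U` and meridian number `W`**: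
`(√(4 + Re W) Re U, √(4 + Re W) Im U, Im W / 4)` (written with the factors `1 *`, `1/4 *` of
`ambientMatrixMap`). [folklore] -/
def ptOf (U W : ℂ) : EuclideanSpace ℝ (Fin 3) :=
  !₂[√(4 + 1 * W.re) * U.re, √(4 + 1 * W.re) * U.im, 1 / 4 * W.im]

/-- First coordinate of `ptOf`. [folklore] -/
@[simp] theorem ptOf_apply_zero (U W : ℂ) : ptOf U W 0 = √(4 + 1 * W.re) * U.re := by simp [ptOf]

/-- Second coordinate of `ptOf`. [folklore] -/
@[simp] theorem ptOf_apply_one (U W : ℂ) : ptOf U W 1 = √(4 + 1 * W.re) * U.im := by simp [ptOf]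

/-- Third coordinate of `ptOf`. [folklore] -/
@[simp] theorem ptOf_apply_two (U W : ℂ) : ptOf U W 2 = 1 / 4 * W.im := by simp [ptOf]

/-- `ambientMatrixMap a b c d` is `ptOf` of the two angle numbers `ambU a b`, `ambU c d`. [folklore] -/
theorem ambientMatrixMap_eq_ptOf (a b c d : ℤ) (q : EuclideanSpace ℝ (Fin 3)) :
    ambientMatrixMap a b c d q = ptOf (ambU a b q) (ambU c d q) := by
  ext i
  fin_cases i
  · show ambientMatrixMap a b c d q 0 = ptOf (ambU a b q) (ambU c d q) 0
    rw [ambientMatrixMap_apply_zero, ptOf_apply_zero]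
  · show ambientMatrixMap a b c d q 1 = ptOf (ambU a b q) (ambU c d q) 1
    rw [ambientMatrixMap_apply_one, ptOf_apply_one]
  · show ambientMatrixMap a b c d q 2 = ptOf (ambU a b q) (ambU c d q) 2
    rw [ambientMatrixMap_apply_two, ptOf_apply_two]

/-- `x² + y²` of `ptOf U W` is `4 + Re W` (for a unit `U` and `4 + Re W ≥ 0`). [folklore] -/
theorem sq_add_sq_ptOf {U W : ℂ} (hU : Complex.normSq U = 1) (hW : 0 ≤ 4 + 1 * W.re) :
    ptOf U W 0 ^ 2 + ptOf U W 1 ^ 2 = 4 + 1 * W.re := by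
  rw [Complex.normSq_apply] at hU
  have hs := Real.sq_sqrt hW
  calc ptOf U W 0 ^ 2 + ptOf U W 1 ^ 2
      = √(4 + 1 * W.re) ^ 2 * (U.re * U.re + U.im * U.im) := by
        rw [ptOf_apply_zero, ptOf_apply_one]; ring
    _ = 4 + 1 * W.re := by rw [hs, hU, mul_one]

/-- **The meridian number of `ptOf U W` is `W`.** [folklore] -/
theorem merC_ptOf {U W : ℂ} (hU : Complex.normSq U = 1) (hW : 0 ≤ 4 + 1 * W.re) :
    merC (ptOf U W) = W := by
  apply Complex.ext
  · rw [merC_re, sq_add_sq_ptOf hU hW]; ring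
  · rw [merC_im, ptOf_apply_two]; ring

/-- **The longitude number of `ptOf U W` is `U`.** [folklore] -/
theorem longC_ptOf {U W : ℂ} (hU : Complex.normSq U = 1) (hW : 0 < 4 + 1 * W.re) :
    longC (ptOf U W) = U := by
  have hs : 0 < √(4 + 1 * W.re) := Real.sqrt_pos.2 hW
  have hr : √(ptOf U W 0 ^ 2 + ptOf U W 1 ^ 2) = √(4 + 1 * W.re) := by rw [sq_add_sq_ptOf hU hW.le]
  apply Complex.ext
  · rw [longC_re, hr, ptOf_apply_zero, mul_comm (√(4 + 1 * W.re)) U.re, mul_inv_cancel_right₀ hs.ne']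
  · rw [longC_im, hr, ptOf_apply_one, mul_comm (√(4 + 1 * W.re)) U.im, mul_inv_cancel_right₀ hs.ne']

/-- **Off the `z`-axis a point is determined by its longitude and meridian numbers.** [folklore] -/
theorem ptOf_longC_merC {q : EuclideanSpace ℝ (Fin 3)} (hq : 0 < q 0 ^ 2 + q 1 ^ 2) :
    ptOf (longC q) (merC q) = q := by
  have hr : 4 + 1 * (merC q).re = q 0 ^ 2 + q 1 ^ 2 := by rw [merC_re]; ring
  have hs : 0 < √(q 0 ^ 2 + q 1 ^ 2) := Real.sqrt_pos.2 hq
  ext i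
  fin_cases i
  · show ptOf (longC q) (merC q) 0 = q 0
    rw [ptOf_apply_zero, hr, longC_re]; field_simp
  · show ptOf (longC q) (merC q) 1 = q 1
    rw [ptOf_apply_one, hr, longC_im]; field_simp
  · show ptOf (longC q) (merC q) 2 = q 2
    rw [ptOf_apply_two, merC_im]; ring

/-! ### §2 The meridional twists `E_{a,c} = ambientMatrixMap a 0 c 1` -/

/-- `ambU a 0 = longC ^ a`. [folklore] -/
theorem ambU_zero (a : ℤ) (q : EuclideanSpace ℝ (Fin 3)) : ambU a 0 q = longC q ^ a := by
  rw [ambU, zpow_zero, mul_one]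

/-- `ambU c 1 = longC ^ c · merC`. [folklore] -/
theorem ambU_one (c : ℤ) (q : EuclideanSpace ℝ (Fin 3)) : ambU c 1 q = longC q ^ c * merC q := by
  rw [ambU, zpow_one]

/-- `ambU a 0` is a unit off the `z`-axis. [folklore] -/
theorem normSq_ambU_zero {q : EuclideanSpace ℝ (Fin 3)} (hq : 0 < q 0 ^ 2 + q 1 ^ 2) (a : ℤ) :
    Complex.normSq (ambU a 0 q) = 1 := by
  rw [ambU_zero, map_zpow₀, normSq_longC hq, one_zpow]

/-- `|ambU c 1| = |merC|` off the `z`-axis (the twist preserves the meridian radius). [folklore] -/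
theorem normSq_ambU_one {q : EuclideanSpace ℝ (Fin 3)} (hq : 0 < q 0 ^ 2 + q 1 ^ 2) (c : ℤ) :
    Complex.normSq (ambU c 1 q) = Complex.normSq (merC q) := by
  rw [ambU_one, map_mul, map_zpow₀, normSq_longC hq, one_zpow, one_mul]

/-- On `{G ≤ 0}` the twisted meridian number has real part `≥ −1`. [folklore] -/
theorem neg_one_le_re_ambU_one {q : EuclideanSpace ℝ (Fin 3)} (hq : 0 < q 0 ^ 2 + q 1 ^ 2)
    (hG : G q ≤ 0) (c : ℤ) : -1 ≤ (ambU c 1 q).re := by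
  have h1 : Complex.normSq (ambU c 1 q) ≤ 1 := by
    rw [normSq_ambU_one hq]; linarith [G_eq_normSq_merC q]
  have h2 : |(ambU c 1 q).re| ≤ ‖ambU c 1 q‖ := Complex.abs_re_le_norm _
  have h3 : ‖ambU c 1 q‖ ≤ 1 := by
    rw [Complex.normSq_eq_norm_sq] at h1
    nlinarith [norm_nonneg (ambU c 1 q)]
  linarith [(abs_le.1 (h2.trans h3)).1]

/-- On `{G ≤ 0}`, `4 + Re (ambU c 1) ≥ 3 > 0`. [folklore] -/
theorem four_add_re_ambU_one_pos {q : EuclideanSpace ℝ (Fin 3)} (hq : 0 < q 0 ^ 2 + q 1 ^ 2)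
    (hG : G q ≤ 0) (c : ℤ) : 0 < 4 + 1 * (ambU c 1 q).re := by
  linarith [neg_one_le_re_ambU_one hq hG c]

/-- **The twist multiplies the meridian number by `longC ^ c`.** [folklore] -/
theorem merC_solidTwist {q : EuclideanSpace ℝ (Fin 3)} (hq : 0 < q 0 ^ 2 + q 1 ^ 2) (hG : G q ≤ 0)
    (a c : ℤ) : merC (ambientMatrixMap a 0 c 1 q) = longC q ^ c * merC q := by
  rw [ambientMatrixMap_eq_ptOf, merC_ptOf (normSq_ambU_zero hq a) (four_add_re_ambU_one_pos hq hG c).le,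
    ambU_one]

/-- **The twist raises the longitude number to the power `a`.** [folklore] -/
theorem longC_solidTwist {q : EuclideanSpace ℝ (Fin 3)} (hq : 0 < q 0 ^ 2 + q 1 ^ 2) (hG : G q ≤ 0)
    (a c : ℤ) : longC (ambientMatrixMap a 0 c 1 q) = longC q ^ a := by
  rw [ambientMatrixMap_eq_ptOf, longC_ptOf (normSq_ambU_zero hq a) (four_add_re_ambU_one_pos hq hG c),
    ambU_zero]

/-- **The twist preserves `G`** (hence `V` and `∂V`). [folklore] -/
theorem G_solidTwist {q : EuclideanSpace ℝ (Fin 3)} (hq : 0 < q 0 ^ 2 + q 1 ^ 2) (hG : G q ≤ 0)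
    (a c : ℤ) : G (ambientMatrixMap a 0 c 1 q) = G q := by
  rw [G_eq_normSq_merC, G_eq_normSq_merC q, merC_solidTwist hq hG, map_mul, map_zpow₀, normSq_longC hq, one_zpow,
    one_mul]

/-- The twisted point lies off the `z`-axis. [folklore] -/
theorem sq_add_sq_solidTwist_pos {q : EuclideanSpace ℝ (Fin 3)} (hq : 0 < q 0 ^ 2 + q 1 ^ 2)
    (hG : G q ≤ 0) (a c : ℤ) :
    0 < (ambientMatrixMap a 0 c 1 q) 0 ^ 2 + (ambientMatrixMap a 0 c 1 q) 1 ^ 2 := by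
  rw [ambientMatrixMap_eq_ptOf, sq_add_sq_ptOf (normSq_ambU_zero hq a) (four_add_re_ambU_one_pos hq hG c).le]
  exact four_add_re_ambU_one_pos hq hG c

/-- The twist preserves `{f ≤ 0} = V`. [folklore] -/
theorem fn_solidTwist_nonpos {q : EuclideanSpace ℝ (Fin 3)} (hq : 0 < q 0 ^ 2 + q 1 ^ 2)
    (hfn : fn q ≤ 0) (a c : ℤ) : fn (ambientMatrixMap a 0 c 1 q) ≤ 0 := by
  rw [fn_nonpos_iff] at hfn ⊢
  rw [G_solidTwist hq hfn]
  exact hfn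

/-- **`E_{a,c'} ∘ E_{a,c} = id` on `{G ≤ 0}` for `c' = −ac`** (`a = ±1`): the longitude goes
`θ ↦ aθ ↦ a²θ = θ`, the meridian angle `φ ↦ cθ + φ ↦ c'aθ + cθ + φ = φ`. [folklore] -/
theorem solidTwist_solidTwist {a : ℤ} (ha : a = 1 ∨ a = -1) {c c' : ℤ} (hc : c' = -(a * c))
    {q : EuclideanSpace ℝ (Fin 3)} (hq : 0 < q 0 ^ 2 + q 1 ^ 2) (hG : G q ≤ 0) :
    ambientMatrixMap a 0 c' 1 (ambientMatrixMap a 0 c 1 q) = q := by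
  have hl : longC q ≠ 0 := longC_ne_zero hq
  have haa : a * a = 1 := by rcases ha with rfl | rfl <;> norm_num
  have key : (longC q ^ a) ^ c' * (longC q ^ c * merC q) = merC q := by
    rw [← zpow_mul, ← mul_assoc, ← zpow_add₀ hl,
      show a * c' + c = 0 by rw [hc]; linear_combination (-c) * haa, zpow_zero, one_mul]
  rw [ambientMatrixMap_eq_ptOf, ambU_zero, ambU_one, longC_solidTwist hq hG, merC_solidTwist hq hG,
    ← zpow_mul, haa, zpow_one, key, ptOf_longC_merC hq]

/-- **The twists are smooth near `V`** (off the `z`-axis, where `4 + Re (longC^c merC) > 0`;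
unlike `contDiffAt_ambientMatrixMap` no condition `merC ≠ 0` is needed, the exponent of `merC`
being `1`). [folklore] -/
theorem contDiffAt_solidTwist {q : EuclideanSpace ℝ (Fin 3)} (hq : 0 < q 0 ^ 2 + q 1 ^ 2) (hG : G q ≤ 0)
    (a c : ℤ) : ContDiffAt ℝ ∞ (ambientMatrixMap a 0 c 1) q := by
  have hl : longC q ≠ 0 := longC_ne_zero hq
  have hU : ContDiffAt ℝ ∞ (ambU a 0) q := by
    have h : ambU a 0 = fun q => longC q ^ a := funext (ambU_zero a)
    rw [h]
    exact (contDiffAt_zpow_of_ne_zero hl a).comp q (contDiffAt_longC hq)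
  have hW : ContDiffAt ℝ ∞ (ambU c 1) q := by
    have h : ambU c 1 = fun q => longC q ^ c * merC q := funext (ambU_one c)
    rw [h]
    exact ((contDiffAt_zpow_of_ne_zero hl c).comp q (contDiffAt_longC hq)).mul contDiff_merC.contDiffAt
  have hUre : ContDiffAt ℝ ∞ (fun q => (ambU a 0 q).re) q := Complex.reCLM.contDiff.contDiffAt.comp q hU
  have hUim : ContDiffAt ℝ ∞ (fun q => (ambU a 0 q).im) q := Complex.imCLM.contDiff.contDiffAt.comp q hU
  have hWre : ContDiffAt ℝ ∞ (fun q => (ambU c 1 q).re) q := Complex.reCLM.contDiff.contDiffAt.comp q hW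
  have hWim : ContDiffAt ℝ ∞ (fun q => (ambU c 1 q).im) q := Complex.imCLM.contDiff.contDiffAt.comp q hW
  have hpos : 4 + 1 * (ambU c 1 q).re ≠ 0 := (four_add_re_ambU_one_pos hq hG c).ne'
  have hsqrt : ContDiffAt ℝ ∞ (fun q => √(4 + 1 * (ambU c 1 q).re)) q :=
    (contDiffAt_const.add (contDiffAt_const.mul hWre)).sqrt hpos
  rw [contDiffAt_euclidean]
  intro i
  fin_cases i
  · simp only [ambientMatrixMap_apply_zero, Fin.zero_eta]
    exact hsqrt.mul hUre
  · simp only [ambientMatrixMap_apply_one, Fin.mk_one]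
    exact hsqrt.mul hUim
  · simp only [ambientMatrixMap_apply_two, Fin.reduceFinMk]
    exact contDiffAt_const.mul hWim

/-- **The meridional twist `E_{a,c}` as a self-map of `V`.** [folklore] -/
def solidTwistFun (a c : ℤ) (p : RoundSolidTorus) : RoundSolidTorus :=
  RegularSublevel.mk isRegularLevel_fn (ambientMatrixMap a 0 c 1 (RegularSublevel.incl isRegularLevel_fn p))
    (fn_solidTwist_nonpos (sq_add_sq_pos p) (RegularSublevel.apply_incl_le isRegularLevel_fn p) a c)

/-- `E_{a,c}` on points of `ℝ³` (definitional). [folklore] -/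
@[simp] theorem incl_solidTwistFun (a c : ℤ) (p : RoundSolidTorus) :
    RegularSublevel.incl isRegularLevel_fn (solidTwistFun a c p) =
      ambientMatrixMap a 0 c 1 (RegularSublevel.incl isRegularLevel_fn p) := rfl

/-- **`E_{a,c}` is smooth for the manifold-with-boundary structure of `V`**: it is the
restriction of a map smooth near `V` with values in the regular domain `V` (Lee (2013),
Cor. 5.30). [cite: LeeSmoothManifolds2013, Cor. 5.30] -/
theorem contMDiff_solidTwistFun (a c : ℤ) : ContMDiff (𝓡∂ 3) (𝓡∂ 3) ∞ (solidTwistFun a c) := by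
  intro p
  have h1 : ContMDiffAt (𝓡∂ 3) (𝓡 3) ∞
      (fun p : RoundSolidTorus => ambientMatrixMap a 0 c 1 (RegularSublevel.incl isRegularLevel_fn p)) p :=
    (contDiffAt_solidTwist (sq_add_sq_pos p) (G_incl_nonpos p) a c).contMDiffAt.comp p
      ((RegularSublevel.contMDiff_incl isRegularLevel_fn) p)
  exact HalfSliceAtlas.contMDiffAt_codRestrict (RegularSublevel.halfSliceAtlas isRegularLevel_fn)
    (g := fun p : RoundSolidTorus => ambientMatrixMap a 0 c 1 (RegularSublevel.incl isRegularLevel_fn p))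
    (fun p => (solidTwistFun a c p).2) h1

/-- **The meridional twist `E_{a,c}` (`a = ±1`, `c ∈ ℤ`) as a self-diffeomorphism of the round
solid torus `V`**, with inverse `E_{a,−ac}`: `c` Dehn twists along the meridian disc, composed
with the reflection of the longitude when `a = −1`. [folklore] -/
def solidTwistDiffeo (a c : ℤ) (ha : a = 1 ∨ a = -1) :
    RoundSolidTorus ≃ₘ⟮𝓡∂ 3, 𝓡∂ 3⟯ RoundSolidTorus where
  toFun := solidTwistFun a c
  invFun := solidTwistFun a (-(a * c))
  left_inv p := RegularSublevel.injective_incl isRegularLevel_fn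
    (solidTwist_solidTwist ha rfl (sq_add_sq_pos p) (G_incl_nonpos p))
  right_inv p := RegularSublevel.injective_incl isRegularLevel_fn
    (solidTwist_solidTwist ha (by rcases ha with rfl | rfl <;> ring) (sq_add_sq_pos p) (G_incl_nonpos p))
  contMDiff_toFun := contMDiff_solidTwistFun a c
  contMDiff_invFun := contMDiff_solidTwistFun a _

/-- `solidTwistDiffeo` as a function. [folklore] -/
@[simp] theorem solidTwistDiffeo_apply (a c : ℤ) (ha : a = 1 ∨ a = -1) (p : RoundSolidTorus) :
    solidTwistDiffeo a c ha p = solidTwistFun a c p := rfl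

/-! ### §3 The mirror `z ↦ −z` of `V` -/

/-- The Morse function `f = G · E` of `V` is invariant under `(x, y, z) ↦ (x, y, −z)` (`G` is even
in `z`, the tilt `E` does not involve `z`). [folklore] -/
theorem fn_reflectThird (p : EuclideanSpace ℝ (Fin 3)) : fn (reflectThird p) = fn p := by
  simp only [fn, G, E, kf, reflectThird_apply, reflectThirdCLE_apply_coord]
  simp only [Fin.isValue, show (0 : Fin 3) ≠ 2 by decide, show (1 : Fin 3) ≠ 2 by decide,
    ↓reduceIte]
  ring_nf

/-- **The mirror symmetry of `V`** (`RegularSublevel.mirror`). [folklore] -/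
def mirrorDiffeo : RoundSolidTorus ≃ₘ⟮𝓡∂ 3, 𝓡∂ 3⟯ RoundSolidTorus :=
  RegularSublevel.mirror isRegularLevel_fn fn_reflectThird

/-- The mirror on points of `ℝ³` (definitional). [folklore] -/
@[simp] theorem incl_mirrorDiffeo (p : RoundSolidTorus) :
    RegularSublevel.incl isRegularLevel_fn (mirrorDiffeo p) = reflectThird (RegularSublevel.incl isRegularLevel_fn p) :=
  rfl

/-- The mirror on the parametrised torus: `(θ, φ) ↦ (θ, −φ)`. [folklore] -/
theorem reflectThird_torusParam (θφ : Real.Angle × Real.Angle) :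
    reflectThird (torusParam 4 1 (1 / 4) θφ) = torusParam 4 1 (1 / 4) (θφ.1, -θφ.2) := by
  ext i
  fin_cases i
  · show reflectThirdCLE (torusParam 4 1 (1 / 4) θφ) 0 = torusParam 4 1 (1 / 4) (θφ.1, -θφ.2) 0
    rw [reflectThirdCLE_apply_coord, torusParam_apply_zero, torusParam_apply_zero]
    simp [torusRadius, Real.Angle.cos_neg]
  · show reflectThirdCLE (torusParam 4 1 (1 / 4) θφ) 1 = torusParam 4 1 (1 / 4) (θφ.1, -θφ.2) 1
    rw [reflectThirdCLE_apply_coord, torusParam_apply_one, torusParam_apply_one]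
    simp [torusRadius, Real.Angle.cos_neg]
  · show reflectThirdCLE (torusParam 4 1 (1 / 4) θφ) 2 = torusParam 4 1 (1 / 4) (θφ.1, -θφ.2) 2
    rw [reflectThirdCLE_apply_coord, torusParam_apply_two, torusParam_apply_two]
    simp [Real.Angle.sin_neg]

/-- **On `∂V` the mirror is the linear map `(1 0; 0 −1)`**: `incl ∘ M_{(1 0; 0 −1)} = reflect ∘ incl`.
[folklore] -/
theorem incl_boundaryMatrixFun_reflect (z : (𝓡∂ 3).boundary RoundSolidTorus) :
    RegularSublevel.incl isRegularLevel_fn (boundaryMatrixFun 1 0 0 (-1) z).1 =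
      reflectThird (RegularSublevel.incl isRegularLevel_fn z.1) := by
  rw [boundaryMatrixFun, incl_boundaryHomeomorphAngle_symm, ← torusParam_boundaryHomeomorphAngle z,
    reflectThird_torusParam]
  congr 1
  simp [angleMatrixMap]

/-- The matrix identity `(1 0; 0 −1)(a 0; −c 1) = (a 0; c −1)` on `∂V`. [folklore] -/
theorem boundaryMatrixFun_reflect_comp (a c : ℤ) (z : (𝓡∂ 3).boundary RoundSolidTorus) :
    boundaryMatrixFun 1 0 0 (-1) (boundaryMatrixFun a 0 (-c) 1 z) = boundaryMatrixFun a 0 c (-1) z := by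
  rw [boundaryMatrixFun, boundaryMatrixFun, boundaryMatrixFun, Homeomorph.apply_symm_apply]
  congr 1
  obtain ⟨θ, φ⟩ := boundaryHomeomorphAngle z
  simp only [angleMatrixMap, Prod.mk.injEq]
  constructor <;> module

/-! ### §4 Extendability of the lower-triangular matrices -/

/-- **A self-diffeomorphism of `∂V` given by a lower-triangular matrix `(a 0; c d)`, `a, d = ±1`,
extends to a self-diffeomorphism of the solid torus `V`** (`BoundaryData.DiffeoExtends` for the
boundary datum `BoundaryManifold.boundaryData 2 V`): for `d = 1` by the meridional twist `E_{a,c}`,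
for `d = −1` by `mirror ∘ E_{a,−c}`.  These matrices are the stabiliser in `GL(2, ℤ)` of the
meridian subgroup `⟨g₂⟩ = ker (π₁ ∂V → π₁ V)`; their extendability is the constructive half of
Griffiths' theorem (1964) in genus `1`. [cite: GriffithsHB1964Handlebody, main theorem (genus 1)] -/
theorem diffeoExtends_of_coe_eq_boundaryMatrixFun
    (F : (𝓡∂ 3).boundary RoundSolidTorus ≃ₘ⟮𝓡 2, 𝓡 2⟯ (𝓡∂ 3).boundary RoundSolidTorus)
    {a c d : ℤ} (ha : a = 1 ∨ a = -1) (hd : d = 1 ∨ d = -1)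
    (hF : ∀ z, F z = boundaryMatrixFun a 0 c d z) :
    (BoundaryManifold.boundaryData 2 RoundSolidTorus).DiffeoExtends F := by
  rcases hd with rfl | rfl
  · refine ⟨solidTwistDiffeo a c ha, funext fun z => ?_⟩
    show solidTwistFun a c z.1 = (F z).1
    rw [hF]
    apply RegularSublevel.injective_incl isRegularLevel_fn
    rw [incl_solidTwistFun, incl_boundaryMatrixFun]
  · refine ⟨(solidTwistDiffeo a (-c) ha).trans mirrorDiffeo, funext fun z => ?_⟩
    show mirrorDiffeo (solidTwistFun a (-c) z.1) = (F z).1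
    rw [hF, ← boundaryMatrixFun_reflect_comp]
    apply RegularSublevel.injective_incl isRegularLevel_fn
    rw [incl_mirrorDiffeo, incl_solidTwistFun, incl_boundaryMatrixFun_reflect, incl_boundaryMatrixFun]

/-- **The linear diffeomorphisms `boundaryMatrixDiffeo a 0 c d …` (`a, d = ±1`) of `∂V` extend over
the solid torus `V`.** [cite: GriffithsHB1964Handlebody, main theorem (genus 1)] -/
theorem diffeoExtends_boundaryMatrixDiffeo (a b c d a' b' c' d' : ℤ) (ha : a = 1 ∨ a = -1)
    (hb : b = 0) (hd : d = 1 ∨ d = -1)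
    (h : a' * a + b' * c = 1 ∧ a' * b + b' * d = 0 ∧ c' * a + d' * c = 0 ∧ c' * b + d' * d = 1)
    (h' : a * a' + b * c' = 1 ∧ a * b' + b * d' = 0 ∧ c * a' + d * c' = 0 ∧ c * b' + d * d' = 1) :
    (BoundaryManifold.boundaryData 2 RoundSolidTorus).DiffeoExtends
      (boundaryMatrixDiffeo a b c d a' b' c' d' h h') := by
  subst hb
  exact diffeoExtends_of_coe_eq_boundaryMatrixFun _ ha hd fun z => rfl

end RoundSolidTorusModel

end Literature.Topology.FourManifolds

end
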